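import Summits.ValiantsHypothesis.ValiantsHypothesis.Theorems.FeketeSOSHard.Negative.KillCriterion

/-!
# `FeketeSOS.SOSMagnification` (stmt-ValiantsHypothesis-3995) — negative side: the Sárközy calibration of X

Standing disprover of the magnification crux (cdisprove gen 4 / cycle 4), from
`Cruxes/SOSMagnification/Disproof.lean` §Cycle 4.  The crux is `X → ValiantsHypothesis` with
X = `FeketeSOSHard`; this file calibrates X against the (integer form of) SÁRKÖZY'S CONJECTURE on additive
decompositions of the quadratic residues.

* `fekete_eq_two_mul_qrPoly_sub_ones` — `F_p = 2·Q_p − (x + ⋯ + x^{p-1})` with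
  `Q_p := ∑_{m<p, (m|p)=1} x^m` the quadratic-residue polynomial.
* `feketeSOSHard_false_of_sparseQRSplits` — if for every `δ > 0` there are arbitrarily large primes `p` whose
  residue polynomial splits, `Q_p = A·B` in `ℂ[x]`, with `16(|supp A| + |supp B|) ≤ p^{1/2+δ}`, then X fails:
  `F_p = 2AB − (x+⋯+x^a)(∑_{j<b}x^{aj}) − x^{ab+1}(1+⋯+x^{r-1})` (`p − 1 = ab + r`, `a = ⌊√(p−1)⌋`) is three cheap
  products, i.e. six weighted squares (sibling kill criterion `feketeSOSHard_false_of_cheapProducts`).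
  An INTEGER SÁRKÖZY PAIR — finite `𝒜, ℬ ⊂ ℕ` with every quadratic residue in `[1, p−1]` written uniquely as
  `a + b` and nothing else so written — is exactly a splitting `Q_p = (∑_{a∈𝒜} x^a)(∑_{b∈ℬ} x^b)` with
  `|supp| = |𝒜|, |ℬ|`; so, contrapositively, X implies that for all large `p` the quadratic residues modulo `p`,
  read in `[1, p−1]`, are not a direct sum `𝒜 + ℬ` of sets of integers with `|𝒜| + |ℬ| ≤ p^{1/2+δ}/16` — the
  balanced integer case of Sárközy's conjecture (Sarkozy2012; balance `|𝒜|,|ℬ| ≍ √p` is automatic by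
  Shkredov's theorem, and the conjecture itself is now a theorem of Kalmynin, arXiv:2504.10202, for large `p`).
  Any proof of X therefore contains a proof of that statement, in a form robust under complex WEIGHTS
  (`A, B` arbitrary in `ℂ[x]`, not indicator polynomials): the cheapest known lever of that shape is the
  Stepanov-type argument of HansonPetridis2020/Kalmynin, which is where X's provers should start. [folklore]
-/

namespace Summit.ValiantsHypothesis.ValiantsHypothesis.Theorems.SOSMagnification.Negative

set_option linter.dupNamespace false

open Polynomial Finset
open Summit.ValiantsHypothesis.ValiantsHypothesis.Theses.FeketeSOS
open Summit.ValiantsHypothesis.ValiantsHypothesis.Theorems.FeketeSOSHard.Negative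

noncomputable section

/-- `F_p = 2·Q_p − (x + ⋯ + x^{p-1})`, `Q_p = ∑_{m<p,(m|p)=1} x^m`: for `0 < m < p` the Legendre symbol is `±1`,
i.e. `2·[(m|p)=1] − 1`, and `(0|p) = 0`. [folklore] -/
theorem fekete_eq_two_mul_qrPoly_sub_ones (p : ℕ) [Fact p.Prime] :
    (∑ m ∈ range p, C ((legendreSym p m : ℤ) : ℂ) * X ^ m) =
      2 * (∑ m ∈ (range p).filter (fun m : ℕ => legendreSym p m = 1), (X : ℂ[X]) ^ m) -
        ∑ m ∈ range (p - 1), (X : ℂ[X]) ^ (m + 1) := by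
  have hp : p = (p - 1) + 1 := (Nat.succ_pred_eq_of_pos (Fact.out : p.Prime).pos).symm
  have hones : (∑ m ∈ range (p - 1), (X : ℂ[X]) ^ (m + 1)) =
      ∑ m ∈ range p, if m = 0 then (0 : ℂ[X]) else X ^ m := by
    conv_rhs => rw [hp, sum_range_succ']
    simp
  rw [hones, sum_filter, mul_sum, ← sum_sub_distrib]
  refine sum_congr rfl fun m hm => ?_
  rcases Nat.eq_zero_or_pos m with rfl | hm0
  · simp
  · have hmp : m < p := mem_range.mp hm
    have h0 : ((m : ℤ) : ZMod p) ≠ 0 := by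
      rw [Int.cast_natCast, Ne, ZMod.natCast_eq_zero_iff]
      exact Nat.not_dvd_of_pos_of_lt hm0 hmp
    rw [if_neg hm0.ne']
    rcases legendreSym.eq_one_or_neg_one p h0 with h1 | h1
    · rw [h1, if_pos rfl]; simp; ring
    · rw [h1, if_neg (by decide)]; simp

/-- The residue polynomial `Q_p` has the term `x` (`(1|p) = 1`), so it is nonzero. -/
theorem qrPoly_ne_zero (p : ℕ) [Fact p.Prime] :
    (∑ m ∈ (range p).filter (fun m : ℕ => legendreSym p m = 1), (X : ℂ[X]) ^ m) ≠ 0 := by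
  intro h
  have h1 : 1 ∈ (range p).filter (fun m : ℕ => legendreSym p m = 1) := by
    rw [mem_filter, mem_range]
    exact ⟨(Fact.out : p.Prime).one_lt, by exact_mod_cast legendreSym.at_one p⟩
  have hc := congrArg (fun q : ℂ[X] => q.coeff 1) h
  simp only [finsetSum_coeff, coeff_X_pow, coeff_zero, sum_ite_eq] at hc
  rw [if_pos h1] at hc
  exact one_ne_zero hc

/-- `deg Q_p < p`. -/
theorem natDegree_qrPoly_lt (p : ℕ) [Fact p.Prime] :
    (∑ m ∈ (range p).filter (fun m : ℕ => legendreSym p m = 1), (X : ℂ[X]) ^ m).natDegree < p := by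
  have hp : 0 < p := (Fact.out : p.Prime).pos
  refine lt_of_le_of_lt (natDegree_sum_le_of_forall_le _ _ fun m hm => natDegree_X_pow_le _ |>.trans ?_)
    (Nat.sub_lt hp Nat.one_pos)
  have := mem_range.mp (mem_filter.mp hm).1
  omega

/-- **Sárközy calibration (kill criterion via residue splittings).**  If for every `δ > 0` and every `p₀`
some prime `p ≥ p₀` admits a splitting `Q_p = A·B` of its quadratic-residue polynomial in `ℂ[x]` with
`16(|supp A| + |supp B|) ≤ p^{1/2+δ}`, then `FeketeSOSHard` is false — `F_p = 2AB − (x+⋯+x^{p−1})` and the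
all-ones polynomial is two digit products, so `F_p` is three cheap products (six weighted squares).  Instances
would be balanced integer Sárközy pairs `QR_p ∩ [1,p−1] = 𝒜 ⊕ ℬ` (`A, B` their indicator polynomials); none
exist for large `p` (Kalmynin 2025), so this is a CALIBRATION of X, not a kill: X ⊒ balanced integer Sárközy,
weight-robustly. [folklore] -/
theorem feketeSOSHard_false_of_sparseQRSplits
    (h : ∀ δ : ℝ, 0 < δ → ∀ p₀ : ℕ, ∃ (p : ℕ) (_ : Fact p.Prime), p₀ ≤ p ∧ ∃ A B : ℂ[X],
      A * B = ∑ m ∈ (range p).filter (fun m : ℕ => legendreSym p m = 1), (X : ℂ[X]) ^ m ∧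
      16 * ((A.support.card : ℝ) + B.support.card) ≤ (p : ℝ) ^ (1 / 2 + δ)) :
    ¬ FeketeSOSHard := by
  apply feketeSOSHard_false_of_cheapProducts
  intro δ hδ p₀
  obtain ⟨p, hp, hp₀, A, B, hAB, hsmall⟩ := h δ hδ (max p₀ (⌈(16 : ℝ) ^ (1 / δ)⌉₊ + 2))
  have hpprime : p.Prime := hp.out
  refine ⟨p, hp, le_trans (le_max_left _ _) hp₀, ?_⟩
  obtain ⟨N, rfl⟩ : ∃ N, p = N + 1 := ⟨p - 1, (Nat.succ_pred_eq_of_pos hpprime.pos).symm⟩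
  -- digits of N = p - 1 : N = a * b + r, a = ⌊√N⌋
  set a := Nat.sqrt N with ha
  set b := N / a with hb
  set r := N % a with hr
  have hN1 : 1 ≤ N := by have := hpprime.two_le; omega
  have ha1 : 1 ≤ a := by rw [ha]; exact Nat.le_sqrt.mpr (by simpa using hN1)
  have hNabr : N = a * b + r := by rw [hb, hr]; exact (Nat.div_add_mod N a).symm
  have hra : r < a := by rw [hr]; exact Nat.mod_lt _ ha1
  have haa : a * a ≤ N := by rw [ha]; exact Nat.sqrt_le N
  have hNlt : N < (a + 1) * (a + 1) := by rw [ha]; exact Nat.lt_succ_sqrt N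
  have hb_le : b ≤ a + 2 := by
    rw [hb]
    have : N ≤ a * (a + 2) := by nlinarith
    calc N / a ≤ (a * (a + 2)) / a := Nat.div_le_div_right this
      _ = a + 2 := Nat.mul_div_cancel_left _ ha1
  have hab : a * b ≤ N := hNabr ▸ Nat.le_add_right _ _
  have hrN : r ≤ N := hNabr ▸ Nat.le_add_left _ _
  have haN : a ≤ N := (Nat.le_mul_self a).trans haa
  have hsq : N + 1 ≤ (N + 1) ^ 2 := Nat.le_self_pow two_ne_zero _
  -- the witness: three products
  set Q : ℂ[X] := ∑ m ∈ (range (N + 1)).filter (fun m : ℕ => legendreSym (N + 1) m = 1), (X : ℂ[X]) ^ m with hQ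
  set T : ℂ[X] := ∑ k ∈ range r, X ^ k with hT
  set M : ℂ[X] := X ^ (a * b + 1) with hM
  have hQ0 : Q ≠ 0 := qrPoly_ne_zero (N + 1)
  have hA0 : A ≠ 0 := fun h0 => hQ0 (by rw [← hAB, h0, zero_mul])
  have hB0 : B ≠ 0 := fun h0 => hQ0 (by rw [← hAB, h0, mul_zero])
  have hdegQ : Q.natDegree < N + 1 := natDegree_qrPoly_lt (N + 1)
  have hdegA : A.natDegree ≤ (N + 1) ^ 2 :=
    ((natDegree_le_of_dvd (Dvd.intro _ hAB) hQ0).trans hdegQ.le).trans hsq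
  have hdegB : B.natDegree ≤ (N + 1) ^ 2 :=
    ((natDegree_le_of_dvd (Dvd.intro_left _ hAB) hQ0).trans hdegQ.le).trans hsq
  refine ⟨3, ![C 2 * A, -lowDigits a, -M], ![B, highDigits a b, T], ?_, ?_, ?_, ?_, ?_⟩
  · -- 3 + 3 ≤ p ^ δ (indeed 16 ≤ p ^ δ)
    have hp1 : (1 : ℝ) ≤ ((N + 1 : ℕ) : ℝ) := by exact_mod_cast Nat.succ_le_succ (Nat.zero_le N)
    have hceil : (16 : ℝ) ^ (1 / δ) ≤ ((N + 1 : ℕ) : ℝ) := by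
      have h1 : (⌈(16 : ℝ) ^ (1 / δ)⌉₊ : ℝ) ≤ ((N + 1 : ℕ) : ℝ) := by
        have : ⌈(16 : ℝ) ^ (1 / δ)⌉₊ ≤ N + 1 := le_trans (by omega) (le_of_max_le_right hp₀)
        exact_mod_cast this
      exact le_trans (Nat.le_ceil _) h1
    have hpδ : (16 : ℝ) ≤ ((N + 1 : ℕ) : ℝ) ^ δ := by
      have : ((16 : ℝ) ^ (1 / δ)) ^ δ ≤ ((N + 1 : ℕ) : ℝ) ^ δ :=
        Real.rpow_le_rpow (by positivity) hceil hδ.le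
      rwa [← Real.rpow_mul (by norm_num), one_div_mul_cancel hδ.ne', Real.rpow_one] at this
    calc ((3 + 3 : ℕ) : ℝ) = 6 := by norm_num
      _ ≤ 16 := by norm_num
      _ ≤ _ := hpδ
  · intro l
    fin_cases l
    · exact (natDegree_C_mul_le _ _).trans hdegA
    · show (-lowDigits a).natDegree ≤ (N + 1) ^ 2
      rw [natDegree_neg]; exact (natDegree_lowDigits a).trans (by omega)
    · show (-M).natDegree ≤ (N + 1) ^ 2
      rw [natDegree_neg, hM]; exact (natDegree_X_pow_le _).trans (by nlinarith)
  · intro l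
    fin_cases l
    · exact hdegB
    · show (highDigits a b).natDegree ≤ (N + 1) ^ 2
      exact (natDegree_highDigits a b).trans (by nlinarith)
    · show T.natDegree ≤ (N + 1) ^ 2
      rw [hT]
      exact natDegree_sum_le_of_forall_le _ _ fun k hk => (natDegree_X_pow_le _).trans (by
        have := mem_range.mp hk; omega)
  · -- the identity  2AB − low·high − x^{ab+1}·T = F_p
    rw [Fin.sum_univ_three]
    simp only [Matrix.cons_val_zero, Matrix.cons_val_one, Matrix.cons_val_two, Matrix.head_cons,
      Matrix.tail_cons]
    rw [fekete_eq_two_mul_qrPoly_sub_ones, ← hQ, ← hAB, show N + 1 - 1 = N from rfl]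
    conv_rhs => rw [hNabr, ones_digit_identity, ← hM, ← hT]
    rw [map_ofNat]
    ring
  · -- support-sum bookkeeping: 2(|A|+|B|+a+b+1+r) < p^{1/2+δ}
    have hp1 : (1 : ℝ) ≤ ((N + 1 : ℕ) : ℝ) := by exact_mod_cast Nat.succ_le_succ (Nat.zero_le N)
    have hp0 : (0 : ℝ) < ((N + 1 : ℕ) : ℝ) := lt_of_lt_of_le zero_lt_one hp1
    have hceil : (16 : ℝ) ^ (1 / δ) ≤ ((N + 1 : ℕ) : ℝ) := by
      have h1 : (⌈(16 : ℝ) ^ (1 / δ)⌉₊ : ℝ) ≤ ((N + 1 : ℕ) : ℝ) := by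
        have : ⌈(16 : ℝ) ^ (1 / δ)⌉₊ ≤ N + 1 := le_trans (by omega) (le_of_max_le_right hp₀)
        exact_mod_cast this
      exact le_trans (Nat.le_ceil _) h1
    have hpδ : (16 : ℝ) ≤ ((N + 1 : ℕ) : ℝ) ^ δ := by
      have : ((16 : ℝ) ^ (1 / δ)) ^ δ ≤ ((N + 1 : ℕ) : ℝ) ^ δ :=
        Real.rpow_le_rpow (by positivity) hceil hδ.le
      rwa [← Real.rpow_mul (by norm_num), one_div_mul_cancel hδ.ne', Real.rpow_one] at this
    have hsplit : ((N + 1 : ℕ) : ℝ) ^ (1 / 2 + δ) = Real.sqrt ((N + 1 : ℕ) : ℝ) * ((N + 1 : ℕ) : ℝ) ^ δ := by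
      rw [Real.rpow_add hp0, ← Real.sqrt_eq_rpow]
    have hCA : ((C (2 : ℂ) * A).support.card : ℝ) ≤ A.support.card := by
      have : (C (2 : ℂ) * A).support ⊆ A.support := by
        rw [← smul_eq_C_mul]; exact support_smul _ _
      exact_mod_cast card_le_card this
    have hl : ((-lowDigits a).support.card : ℝ) ≤ a := by
      rw [support_neg]; exact_mod_cast card_support_lowDigits a
    have hh : ((highDigits a b).support.card : ℝ) ≤ b := by exact_mod_cast card_support_highDigits a b
    have hMc : ((-M).support.card : ℝ) ≤ 1 := by
      rw [support_neg, hM]; exact_mod_cast card_support_X_pow_le _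
    have hTc : (T.support.card : ℝ) ≤ r := by
      have : T.support.card ≤ r := by
        rw [hT]; exact (card_support_sum_X_pow_le (range r) id).trans (by simp)
      exact_mod_cast this
    have hb' : (b : ℝ) ≤ a + 2 := by exact_mod_cast hb_le
    have hr' : (r : ℝ) + 1 ≤ a := by
      have : r + 1 ≤ a := hra
      exact_mod_cast this
    have hsqrt : (a : ℝ) ≤ Real.sqrt ((N + 1 : ℕ) : ℝ) := by
      rw [← Real.sqrt_sq (Nat.cast_nonneg a)]
      apply Real.sqrt_le_sqrt
      have : ((a * a : ℕ) : ℝ) ≤ ((N + 1 : ℕ) : ℝ) := by exact_mod_cast haa.trans (Nat.le_succ N)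
      push_cast at this ⊢; nlinarith
    have hsqrt1 : (1 : ℝ) ≤ Real.sqrt ((N + 1 : ℕ) : ℝ) := by
      rw [← Real.sqrt_one]; exact Real.sqrt_le_sqrt hp1
    rw [Fin.sum_univ_three]
    simp only [Matrix.cons_val_zero, Matrix.cons_val_one, Matrix.cons_val_two, Matrix.head_cons,
      Matrix.tail_cons]
    rw [hsplit] at hsmall ⊢
    set sq := Real.sqrt ((N + 1 : ℕ) : ℝ) with hsqdef
    set pδ := ((N + 1 : ℕ) : ℝ) ^ δ with hpδdef
    have h1 : 2 * ((((-lowDigits a).support.card : ℝ) + (highDigits a b).support.card) +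
        (((-M).support.card : ℝ) + T.support.card)) ≤ 10 * sq := by linarith
    have h2 : 16 * sq ≤ sq * pδ := by nlinarith
    nlinarith

end

end Summit.ValiantsHypothesis.ValiantsHypothesis.Theorems.SOSMagnification.Negative
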